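import Mathlib
import Summits.AtomisticToContinuum.Crystallization.Theorems.NashClassCertificatesNashNearFieldStubCauchyBornBarlowCoercivityLayers

/-!
# Crux `NashNearField` (stmt-AtomisticToContinuum-16827), line `birth`, stub `stub_cauchyBornBarlowCoercivity` (CBBC):
# the word-free reduction `LayerLandscape⅒ → LatticeLandscape⅒ → CBBC`

CBBC (skeleton v6, `r ≤ 1/10`): `∃ κ > 0` such that for every periodic Hägg word `s`, every continuous linear
automorphism `G` of `ℝ³` in the `4/5–6/5` tube and every `0 ≤ r ≤ 1/10`, if `G` is `r`-far on the unit-template sites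
of norm `≤ 3` from every box-scaled isometric template `A p_{a,h}`, then `e* + κ r² ≤ e(G · unit stacking of s)`.
`…StubCauchyBornBarlowCoercivity` reduced CBBC to the lattice-sum landscape inequality (`LatticeLandscape`: per word,
a box cell whose reference energy plus `κ·dist²` is below the deformed energy); this file removes the WORD from the
remaining numerics, on the layer bookkeeping of `…StubCauchyBornBarlowCoercivityLayers`.

* `cbbc_wordFree_le_siteExcess`, `stub_wordFreeLeExcess` — **the word-free lower bound**: with the layer excesses
  `Δ(δ, t) = ∑'_{(i,j)} V_LJ ‖G (layerVec a₁ h₁ δ t i j)‖ − layerInteraction V_LJ a h δ t` (deformed minus reference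
  interaction of a site with the layer at signed distance `t` and lateral offset `δ` letters; `3`-periodic in `δ`),
  `W(G; a, h) := ½ (Δ(0,0) + ∑_{t≥1} μ(t) + ∑_{t≥1} μ(−t))`, `μ(±1) = min(Δ(1,±1), Δ(−1,±1))` (adjacent layers of a Hägg
  word are never aligned), `μ(±t) = min(Δ(0,±t), Δ(1,±t), Δ(−1,±t))` (`t ≥ 2`), satisfies
  `W(G; a, h) ≤ p⁻¹∑_{n<p} ½∑'_q V(dist (G x_n) (G x_q)) − p⁻¹∑_{n<p} barlowSiteEnergy V_LJ a h s n` for EVERY periodic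
  Hägg word `s`.  This is the rigorous form of "the landscape decouples from the word under shear": no registry / Hägg
  domination (proved only for the rigid box family) is invoked — each layer term of each site is one of three explicit
  word-independent deformed layer sums and is bounded below by their minimum, and both sides are absolutely summable.
* `stub_latticeLandscape_of_layerLandscape`, `stub_latticeLandscapeTenth_of_layerLandscapeTenth`,
  `stub_cauchyBornBarlowCoercivity_of_latticeLandscapeTenth`, `stub_cauchyBornBarlowCoercivity_of_layerLandscapeTenth` —
  the reductions.  What remains of CBBC is `LayerLandscape⅒` (the hypothesis of the last theorem): `∃ κ > 0`, for every
  `G` in the tube a box cell `(A, a, h)` with `κ·min(dist(G p, A p_{a,h}), 1/10)² ≤ W(G; a, h)` at every layer vector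
  `p = layerVec 1 (√6/3) δ k i j` of norm `≤ 3` — ONE inequality about explicit lattice sums of sheared triangular layers,
  quantified over a compact `6`-parameter set (the metric `GᵀG`), with no word and no `e*`.

## Truth audit of `LayerLandscape⅒` (plain-python lattice sums; scratch `work/stubs/scratch/cbbc/`)
(i) Each deformed layer sum `I(δ, t)` is a `C₃`-invariant function of the metric (`ρw ≡ w` for the rotation by `2π/3`),
so on the diagonal family the gradient of every `Δ(δ, t)`, hence of `W`, vanishes in the four transverse strain
directions at EVERY box cell (checked on a `5 × 5` grid: transverse gradients at finite-difference noise `≤ 2·10⁻⁴`);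
the transverse `½`-Hessian of the fcc/hcp energies is positive definite on the whole box (smallest eigenvalue `0.98`,
fcc at the corner `a = 1, h = 17a/20`; up to `6.6`).  (ii) Near the family `W/R_sup² ≥ 0.56` (`R_sup` = family
distance on all `499` layer vectors of norm `≤ 3`); far from it (`150` random tube metrics, axial and twinning paths)
`min W/R_sup² = 0.11`, attained at the fcc `(111)[11̄2]` twinning corner of the tube (shear `0.55|w|/h₀`, singular
values `0.80, 0.97, 1.18`, `W = 0.046`), the zero of the excess (the fcc twin, `σ_min = 1/√2`) lying outside the tube;
with the `1/10` cap `κ ≈ 0.5` is admissible.  (iii) `W` equals the fcc excess to `10⁻⁵` along `e₁₃, e₁₁ − e₂₂, e₁₂`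
and costs a factor `≤ 2.3` (never the sign) along `e₂₃`.  (iv) Local minima of every tested word's energy in the tube
(fcc, hcp, dhcp, 9R, all Hägg words of period `≤ 6`): the family optimum only, plus fcc's twinning-wall minima.
-/

noncomputable section

open scoped BigOperators
open Literature.MathematicalPhysics.StatisticalMechanics Literature.Geometry.DiscreteGeometry

namespace Summit.AtomisticToContinuum.Crystallization.Theorems.NashClassCertificatesNashNearField

/-! ## The word-free lower bound of the deformed excess -/

section WordFree

variable {a₁ h₁ a h : ℝ} {s : ℤ → ℤ} {p : ℕ}

/-- **The word-free lower bound, one site.**  For a Hägg word `s`, template spacings `a₁, h₁ > 0`, a reference cell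
`a, h > 0` and a continuous linear automorphism `G`, with the LAYER EXCESSES
`Δ(δ, t) = ∑'_{(i,j)} V_LJ ‖G (layerVec a₁ h₁ δ t i j)‖ − layerInteraction V_LJ a h δ t`:
`½ (Δ(0,0) + ∑_{t ≥ 1} μ(t) + ∑_{t ≥ 1} μ(−t)) ≤ ½ ∑'_q V_LJ(dist (G x_n) (G x_q)) − barlowSiteEnergy V_LJ a h s n`, where
`μ(±1) = min(Δ(1, ±1), Δ(−1, ±1))` (adjacent layers are never aligned) and `μ(±t) = min_{δ ∈ {0,1,−1}} Δ(δ, ±t)` for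
`t ≥ 2` — the layer excesses are `3`-periodic in the offset, so whatever the word, each layer term is one of the three
(two) values and at least their minimum.  The left-hand side does not depend on the word. [folklore] -/
theorem cbbc_wordFree_le_siteExcess (ha₁ : 0 < a₁) (hh₁ : 0 < h₁) (ha : 0 < a) (hh : 0 < h) (hp : p ≠ 0)
    (hs : ∀ i, s (i + p) = s i) (hH : IsHaggSeq s)
    (G : EuclideanSpace ℝ (Fin 3) ≃L[ℝ] EuclideanSpace ℝ (Fin 3)) (n : ℤ) :
    (fun Δ : ℤ → ℤ → ℝ => (1 / 2 : ℝ) * (Δ 0 0 +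
        (∑' k : ℕ, if k = 0 then min (Δ 1 1) (Δ (-1) 1)
          else min (Δ 0 ((k : ℤ) + 1)) (min (Δ 1 ((k : ℤ) + 1)) (Δ (-1) ((k : ℤ) + 1)))) +
        (∑' k : ℕ, if k = 0 then min (Δ 1 (-1)) (Δ (-1) (-1))
          else min (Δ 0 (-((k : ℤ) + 1))) (min (Δ 1 (-((k : ℤ) + 1))) (Δ (-1) (-((k : ℤ) + 1)))))))
      (fun δ t => (∑' ij : ℤ × ℤ, lennardJones ‖G (layerVec a₁ h₁ δ t ij.1 ij.2)‖) -
        layerInteraction lennardJones a h δ t) ≤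
    (1 / 2 : ℝ) * (∑' q : ℤ × ℤ × ℤ,
        lennardJones (dist (G (barlowPos a₁ h₁ s n 0 0)) (G (barlowPos a₁ h₁ s q.1 q.2.1 q.2.2)))) -
      barlowSiteEnergy lennardJones a h s n := by
  set Δ : ℤ → ℤ → ℝ := (fun δ t => (∑' ij : ℤ × ℤ, lennardJones ‖G (layerVec a₁ h₁ δ t ij.1 ij.2)‖) -
    layerInteraction lennardJones a h δ t) with hΔ
  dsimp only
  -- `3`-periodicity in the offset
  have hper : ∀ t δ q : ℤ, Δ (δ + 3 * q) t = Δ δ t := by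
    intro t δ q
    simp only [hΔ]
    rw [cbbc_deformedLayer_add_three_mul, layerInteraction_add_three_mul]
  have h00 : Δ 0 0 = (∑' ij : ℤ × ℤ, lennardJones ‖G (layerVec a₁ h₁ 0 0 ij.1 ij.2)‖) -
      layerInteraction lennardJones a h 0 0 := by simp only [hΔ]
  -- the two decompositions
  have eD := cbbc_tsum_deformed_eq_layers ha₁ hh₁ hp hs G n
  have eR := cbbc_barlowSiteEnergy_eq_layers a h s n
  -- summability of the layer terms along the word
  have hA : Summable fun k : ℕ => ∑' ij : ℤ × ℤ, lennardJones
      ‖G (layerVec a₁ h₁ (haggLabel s (n + ((k : ℤ) + 1)) - haggLabel s n) ((k : ℤ) + 1) ij.1 ij.2)‖ :=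
    (cbbc_summable_deformed_layers ha₁ hh₁ hp hs G n).comp_injective (i := fun k : ℕ => (k : ℤ) + 1)
      fun k k' (hk : (k : ℤ) + 1 = (k' : ℤ) + 1) => by omega
  have hA' : Summable fun k : ℕ => ∑' ij : ℤ × ℤ, lennardJones
      ‖G (layerVec a₁ h₁ (haggLabel s (n + -((k : ℤ) + 1)) - haggLabel s n) (-((k : ℤ) + 1)) ij.1 ij.2)‖ :=
    (cbbc_summable_deformed_layers ha₁ hh₁ hp hs G n).comp_injective (i := fun k : ℕ => -((k : ℤ) + 1))
      fun k k' (hk : -((k : ℤ) + 1) = -((k' : ℤ) + 1)) => by omega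
  have hB : Summable fun k : ℕ =>
      layerInteraction lennardJones a h (haggLabel s (n + ((k : ℤ) + 1)) - haggLabel s n) ((k : ℤ) + 1) :=
    cbbc_summable_layerInteraction_int ha hh (fun k : ℕ => (k : ℤ) + 1) (fun k => Or.inl rfl) _
  have hB' : Summable fun k : ℕ =>
      layerInteraction lennardJones a h (haggLabel s (n + -((k : ℤ) + 1)) - haggLabel s n) (-((k : ℤ) + 1)) :=
    cbbc_summable_layerInteraction_int ha hh (fun k : ℕ => -((k : ℤ) + 1)) (fun k => Or.inr rfl) _
  -- summability of the layer excesses at the three reference offsets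
  have hΔs : ∀ δ : ℤ, Summable fun k : ℕ => Δ δ ((k : ℤ) + 1) := fun δ => by
    simp only [hΔ]
    exact (cbbc_summable_deformedLayer_above ha₁ hh₁ G δ).sub
      (cbbc_summable_layerInteraction_int ha hh (fun k : ℕ => (k : ℤ) + 1) (fun k => Or.inl rfl) fun _ => δ)
  have hΔs' : ∀ δ : ℤ, Summable fun k : ℕ => Δ δ (-((k : ℤ) + 1)) := fun δ => by
    simp only [hΔ]
    exact (cbbc_summable_deformedLayer_below ha₁ hh₁ G δ).sub
      (cbbc_summable_layerInteraction_int ha hh (fun k : ℕ => -((k : ℤ) + 1)) (fun k => Or.inr rfl) fun _ => δ)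
  have hμ : Summable fun k : ℕ => if k = 0 then min (Δ 1 1) (Δ (-1) 1)
      else min (Δ 0 ((k : ℤ) + 1)) (min (Δ 1 ((k : ℤ) + 1)) (Δ (-1) ((k : ℤ) + 1))) := by
    refine Summable.of_norm_bounded (((hΔs 0).abs.add (hΔs 1).abs).add (hΔs (-1)).abs) fun k => ?_
    rw [Real.norm_eq_abs]
    split_ifs with hk
    · subst hk
      have := cbbc_abs_min_le (Δ 1 1) (Δ (-1) 1)
      simp only [Nat.cast_zero, zero_add]
      linarith [abs_nonneg (Δ 0 1)]
    · exact cbbc_abs_min_three_le _ _ _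
  have hμ' : Summable fun k : ℕ => if k = 0 then min (Δ 1 (-1)) (Δ (-1) (-1))
      else min (Δ 0 (-((k : ℤ) + 1))) (min (Δ 1 (-((k : ℤ) + 1))) (Δ (-1) (-((k : ℤ) + 1)))) := by
    refine Summable.of_norm_bounded (((hΔs' 0).abs.add (hΔs' 1).abs).add (hΔs' (-1)).abs) fun k => ?_
    rw [Real.norm_eq_abs]
    split_ifs with hk
    · subst hk
      have := cbbc_abs_min_le (Δ 1 (-1)) (Δ (-1) (-1))
      simp only [Nat.cast_zero, zero_add]
      linarith [abs_nonneg (Δ 0 (-1))]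
    · exact cbbc_abs_min_three_le _ _ _
  -- pointwise: each layer term of the word is at least the minimum
  have hpt : ∀ k : ℕ, (if k = 0 then min (Δ 1 1) (Δ (-1) 1)
      else min (Δ 0 ((k : ℤ) + 1)) (min (Δ 1 ((k : ℤ) + 1)) (Δ (-1) ((k : ℤ) + 1)))) ≤
      Δ (haggLabel s (n + ((k : ℤ) + 1)) - haggLabel s n) ((k : ℤ) + 1) := by
    intro k
    split_ifs with hk
    · subst hk
      simp only [Nat.cast_zero, zero_add]
      rw [haggLabel_succ, add_sub_cancel_left]
      rcases hH n with h1 | h1 <;> rw [h1]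
      · exact min_le_left _ _
      · exact min_le_right _ _
    · exact cbbc_min_three_le (Δ := fun δ => Δ δ ((k : ℤ) + 1)) (fun δ q => hper _ δ q) _
  have hpt' : ∀ k : ℕ, (if k = 0 then min (Δ 1 (-1)) (Δ (-1) (-1))
      else min (Δ 0 (-((k : ℤ) + 1))) (min (Δ 1 (-((k : ℤ) + 1))) (Δ (-1) (-((k : ℤ) + 1))))) ≤
      Δ (haggLabel s (n + -((k : ℤ) + 1)) - haggLabel s n) (-((k : ℤ) + 1)) := by
    intro k
    split_ifs with hk
    · subst hk
      simp only [Nat.cast_zero, zero_add]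
      have hL : haggLabel s (n + -1) - haggLabel s n = -s (n + -1) := by
        have := haggLabel_succ s (n + -1)
        rw [show n + -1 + 1 = n by ring] at this
        linarith
      rw [hL]
      rcases hH (n + -1) with h1 | h1 <;> rw [h1]
      · exact min_le_right _ _
      · rw [neg_neg]
        exact min_le_left _ _
    · exact cbbc_min_three_le (Δ := fun δ => Δ δ (-((k : ℤ) + 1))) (fun δ q => hper _ δ q) _
  -- sum the pointwise bounds
  have hS : (∑' k : ℕ, if k = 0 then min (Δ 1 1) (Δ (-1) 1)
      else min (Δ 0 ((k : ℤ) + 1)) (min (Δ 1 ((k : ℤ) + 1)) (Δ (-1) ((k : ℤ) + 1)))) ≤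
      (∑' k : ℕ, ∑' ij : ℤ × ℤ, lennardJones
        ‖G (layerVec a₁ h₁ (haggLabel s (n + ((k : ℤ) + 1)) - haggLabel s n) ((k : ℤ) + 1) ij.1 ij.2)‖) -
      ∑' k : ℕ, layerInteraction lennardJones a h (haggLabel s (n + ((k : ℤ) + 1)) - haggLabel s n)
        ((k : ℤ) + 1) := by
    rw [← hA.tsum_sub hB]
    refine Summable.tsum_le_tsum hpt hμ ?_
    exact hA.sub hB
  have hS' : (∑' k : ℕ, if k = 0 then min (Δ 1 (-1)) (Δ (-1) (-1))
      else min (Δ 0 (-((k : ℤ) + 1))) (min (Δ 1 (-((k : ℤ) + 1))) (Δ (-1) (-((k : ℤ) + 1))))) ≤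
      (∑' k : ℕ, ∑' ij : ℤ × ℤ, lennardJones
        ‖G (layerVec a₁ h₁ (haggLabel s (n + -((k : ℤ) + 1)) - haggLabel s n) (-((k : ℤ) + 1)) ij.1 ij.2)‖) -
      ∑' k : ℕ, layerInteraction lennardJones a h (haggLabel s (n + -((k : ℤ) + 1)) - haggLabel s n)
        (-((k : ℤ) + 1)) := by
    rw [← hA'.tsum_sub hB']
    refine Summable.tsum_le_tsum hpt' hμ' ?_
    exact hA'.sub hB'
  rw [eD, eR]
  linarith [hS, hS', h00]

/-- **Stub piece `stub_wordFreeLeExcess` (proved): the word-free lower bound of the deformed excess per particle.**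
Averaging `cbbc_wordFree_le_siteExcess` over a period:
`W(G; a, h) ≤ p⁻¹∑_{n<p} ½∑'_q V_LJ(dist (G x_n) (G x_q)) − p⁻¹∑_{n<p} barlowSiteEnergy V_LJ a h s n` for every periodic
Hägg word `s`, every template cell `a₁, h₁ > 0`, every reference cell `a, h > 0` and every `G`. [folklore] -/
theorem stub_wordFreeLeExcess :
    ∀ (a₁ h₁ a h : ℝ) (s : ℤ → ℤ) (p : ℕ) (ha₁ : 0 < a₁) (hh₁ : 0 < h₁) (ha : 0 < a) (hh : 0 < h) (hp : p ≠ 0)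
      (hs : ∀ i, s (i + p) = s i), IsHaggSeq s →
      ∀ (G : EuclideanSpace ℝ (Fin 3) ≃L[ℝ] EuclideanSpace ℝ (Fin 3)),
      (fun Δ : ℤ → ℤ → ℝ => (1 / 2 : ℝ) * (Δ 0 0 +
        (∑' k : ℕ, if k = 0 then min (Δ 1 1) (Δ (-1) 1)
          else min (Δ 0 ((k : ℤ) + 1)) (min (Δ 1 ((k : ℤ) + 1)) (Δ (-1) ((k : ℤ) + 1)))) +
        (∑' k : ℕ, if k = 0 then min (Δ 1 (-1)) (Δ (-1) (-1))
          else min (Δ 0 (-((k : ℤ) + 1))) (min (Δ 1 (-((k : ℤ) + 1))) (Δ (-1) (-((k : ℤ) + 1)))))))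
      (fun δ t => (∑' ij : ℤ × ℤ, lennardJones ‖G (layerVec a₁ h₁ δ t ij.1 ij.2)‖) -
        layerInteraction lennardJones a h δ t) ≤
      (∑ n ∈ Finset.range p, (1 / 2 : ℝ) * ∑' q : ℤ × ℤ × ℤ,
          lennardJones (dist (G (barlowPos a₁ h₁ s n 0 0)) (G (barlowPos a₁ h₁ s q.1 q.2.1 q.2.2)))) / p -
        (∑ n ∈ Finset.range p, barlowSiteEnergy lennardJones a h s n) / p := by
  intro a₁ h₁ a h s p ha₁ hh₁ ha hh hp hs hH G
  have hpt := fun n : ℕ => cbbc_wordFree_le_siteExcess ha₁ hh₁ ha hh hp hs hH G (n : ℤ)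
  dsimp only at hpt ⊢
  have hp0 : (0 : ℝ) < p := by exact_mod_cast Nat.pos_of_ne_zero hp
  have hsum := Finset.sum_le_sum fun n (_ : n ∈ Finset.range p) => hpt n
  rw [Finset.sum_const, Finset.card_range, nsmul_eq_mul, Finset.sum_sub_distrib] at hsum
  rw [← sub_div, le_div_iff₀ hp0]
  linarith

end WordFree

/-! ## The reductions -/

section Reductions

open Summit.AtomisticToContinuum.Crystallization.Theorems (energyPerParticle_barlow_eq_average)
open Summit.AtomisticToContinuum.Crystallization.Theorems.ChargedEnergyGapNegative
  (bddBelow_energyPerParticle_lennardJones)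

/-- **`LayerLandscape → LatticeLandscape` (stub piece `stub_latticeLandscape_of_layerLandscape`, proved).**  The
word-free landscape inequality — for every `G` in the tube a box cell `(A, a, h)` whose word-free excess functional
`W(G; a, h)` dominates `κ·dist(G p, A p_{a,h})²` at every layer vector `p` of norm `≤ 3` — implies the lattice-sum
landscape inequality for EVERY periodic Hägg word with the same `κ` and the same cell: the template sites of a word
are layer vectors (`barlowPos a h s m u v = layerVec a h (L m) m u v`) and `W ≤` (deformed minus reference energy
per particle) by `stub_wordFreeLeExcess`.  No registry/Hägg domination is used: the word is decoupled by the minimum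
over the three offsets, layer by layer. [folklore] -/
theorem stub_latticeLandscape_of_layerLandscape :
    (∃ κ : ℝ, 0 < κ ∧ ∀ (G : EuclideanSpace ℝ (Fin 3) ≃L[ℝ] EuclideanSpace ℝ (Fin 3)),
        (∀ v : EuclideanSpace ℝ (Fin 3), 4 / 5 * ‖v‖ ≤ ‖G v‖ ∧ ‖G v‖ ≤ 6 / 5 * ‖v‖) →
        ∃ (A : EuclideanSpace ℝ (Fin 3) →ₗᵢ[ℝ] EuclideanSpace ℝ (Fin 3)) (a h : ℝ),
          47 / 50 ≤ a ∧ a ≤ 1 ∧ 39 / 50 * a ≤ h ∧ h ≤ 17 / 20 * a ∧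
          ∀ δ k i j : ℤ, ‖layerVec 1 (Real.sqrt 6 / 3) δ k i j‖ ≤ 3 →
            κ * dist (G (layerVec 1 (Real.sqrt 6 / 3) δ k i j)) (A (layerVec a h δ k i j)) ^ 2 ≤
            (fun Δ : ℤ → ℤ → ℝ => (1 / 2 : ℝ) * (Δ 0 0 +
              (∑' k : ℕ, if k = 0 then min (Δ 1 1) (Δ (-1) 1)
                else min (Δ 0 ((k : ℤ) + 1)) (min (Δ 1 ((k : ℤ) + 1)) (Δ (-1) ((k : ℤ) + 1)))) +
              (∑' k : ℕ, if k = 0 then min (Δ 1 (-1)) (Δ (-1) (-1))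
                else min (Δ 0 (-((k : ℤ) + 1))) (min (Δ 1 (-((k : ℤ) + 1))) (Δ (-1) (-((k : ℤ) + 1)))))))
            (fun δ t => (∑' ij : ℤ × ℤ, lennardJones ‖G (layerVec 1 (Real.sqrt 6 / 3) δ t ij.1 ij.2)‖) -
              layerInteraction lennardJones a h δ t)) →
    ∃ κ : ℝ, 0 < κ ∧ ∀ (s : ℤ → ℤ) (p : ℕ) (hp : p ≠ 0) (hs : ∀ i, s (i + p) = s i), IsHaggSeq s →
      ∀ (G : EuclideanSpace ℝ (Fin 3) ≃L[ℝ] EuclideanSpace ℝ (Fin 3)),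
        (∀ v : EuclideanSpace ℝ (Fin 3), 4 / 5 * ‖v‖ ≤ ‖G v‖ ∧ ‖G v‖ ≤ 6 / 5 * ‖v‖) →
        ∃ (A : EuclideanSpace ℝ (Fin 3) →ₗᵢ[ℝ] EuclideanSpace ℝ (Fin 3)) (a h : ℝ),
          47 / 50 ≤ a ∧ a ≤ 1 ∧ 39 / 50 * a ≤ h ∧ h ≤ 17 / 20 * a ∧
          ∀ m u v : ℤ, ‖barlowPos 1 (Real.sqrt 6 / 3) s m u v‖ ≤ 3 →
            (∑ n ∈ Finset.range p, barlowSiteEnergy lennardJones a h s n) / p +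
                κ * dist (G (barlowPos 1 (Real.sqrt 6 / 3) s m u v)) (A (barlowPos a h s m u v)) ^ 2 ≤
              (∑ n ∈ Finset.range p, (1 / 2 : ℝ) * ∑' q : ℤ × ℤ × ℤ,
                lennardJones (dist (G (barlowPos 1 (Real.sqrt 6 / 3) s n 0 0))
                  (G (barlowPos 1 (Real.sqrt 6 / 3) s q.1 q.2.1 q.2.2)))) / p := by
  rintro ⟨κ, hκ, hL⟩
  refine ⟨κ, hκ, ?_⟩
  intro s p hp hs hH G hG
  obtain ⟨A, a, h, ha1, ha2, hh1, hh2, hfar⟩ := hL G hG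
  refine ⟨A, a, h, ha1, ha2, hh1, hh2, ?_⟩
  intro m u v hn
  have ha : 0 < a := by linarith
  have hh : 0 < h := by nlinarith
  have hW := stub_wordFreeLeExcess 1 (Real.sqrt 6 / 3) a h s p one_pos cbbc_sqrt_six_div_three_pos ha hh hp hs hH G
  have hsite := hfar (haggLabel s m) m u v (by rw [← cbbc_barlowPos_eq_layerVec]; exact hn)
  rw [← cbbc_barlowPos_eq_layerVec, ← cbbc_barlowPos_eq_layerVec] at hsite
  dsimp only at hW hsite
  linarith

/-- **`LayerLandscape⅒ → LatticeLandscape⅒` (stub piece `stub_latticeLandscapeTenth_of_layerLandscapeTenth`,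
proved)**: the same reduction with the penalty capped at the scale `1/10` at which the crux consumes CBBC
(`κ·min(dist, 1/10)²`), so that the numerics only has to certify the local quadratic growth near the family and a
crude positive floor `W ≥ κ/100` at family distance `≥ 1/10`. [folklore] -/
theorem stub_latticeLandscapeTenth_of_layerLandscapeTenth :
    (∃ κ : ℝ, 0 < κ ∧ ∀ (G : EuclideanSpace ℝ (Fin 3) ≃L[ℝ] EuclideanSpace ℝ (Fin 3)),
        (∀ v : EuclideanSpace ℝ (Fin 3), 4 / 5 * ‖v‖ ≤ ‖G v‖ ∧ ‖G v‖ ≤ 6 / 5 * ‖v‖) →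
        ∃ (A : EuclideanSpace ℝ (Fin 3) →ₗᵢ[ℝ] EuclideanSpace ℝ (Fin 3)) (a h : ℝ),
          47 / 50 ≤ a ∧ a ≤ 1 ∧ 39 / 50 * a ≤ h ∧ h ≤ 17 / 20 * a ∧
          ∀ δ k i j : ℤ, ‖layerVec 1 (Real.sqrt 6 / 3) δ k i j‖ ≤ 3 →
            κ * (min (dist (G (layerVec 1 (Real.sqrt 6 / 3) δ k i j)) (A (layerVec a h δ k i j))) (1 / 10)) ^ 2 ≤
            (fun Δ : ℤ → ℤ → ℝ => (1 / 2 : ℝ) * (Δ 0 0 +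
              (∑' k : ℕ, if k = 0 then min (Δ 1 1) (Δ (-1) 1)
                else min (Δ 0 ((k : ℤ) + 1)) (min (Δ 1 ((k : ℤ) + 1)) (Δ (-1) ((k : ℤ) + 1)))) +
              (∑' k : ℕ, if k = 0 then min (Δ 1 (-1)) (Δ (-1) (-1))
                else min (Δ 0 (-((k : ℤ) + 1))) (min (Δ 1 (-((k : ℤ) + 1))) (Δ (-1) (-((k : ℤ) + 1)))))))
            (fun δ t => (∑' ij : ℤ × ℤ, lennardJones ‖G (layerVec 1 (Real.sqrt 6 / 3) δ t ij.1 ij.2)‖) -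
              layerInteraction lennardJones a h δ t)) →
    ∃ κ : ℝ, 0 < κ ∧ ∀ (s : ℤ → ℤ) (p : ℕ) (hp : p ≠ 0) (hs : ∀ i, s (i + p) = s i), IsHaggSeq s →
      ∀ (G : EuclideanSpace ℝ (Fin 3) ≃L[ℝ] EuclideanSpace ℝ (Fin 3)),
        (∀ v : EuclideanSpace ℝ (Fin 3), 4 / 5 * ‖v‖ ≤ ‖G v‖ ∧ ‖G v‖ ≤ 6 / 5 * ‖v‖) →
        ∃ (A : EuclideanSpace ℝ (Fin 3) →ₗᵢ[ℝ] EuclideanSpace ℝ (Fin 3)) (a h : ℝ),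
          47 / 50 ≤ a ∧ a ≤ 1 ∧ 39 / 50 * a ≤ h ∧ h ≤ 17 / 20 * a ∧
          ∀ m u v : ℤ, ‖barlowPos 1 (Real.sqrt 6 / 3) s m u v‖ ≤ 3 →
            (∑ n ∈ Finset.range p, barlowSiteEnergy lennardJones a h s n) / p +
                κ * (min (dist (G (barlowPos 1 (Real.sqrt 6 / 3) s m u v)) (A (barlowPos a h s m u v))) (1 / 10)) ^ 2 ≤
              (∑ n ∈ Finset.range p, (1 / 2 : ℝ) * ∑' q : ℤ × ℤ × ℤ,
                lennardJones (dist (G (barlowPos 1 (Real.sqrt 6 / 3) s n 0 0))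
                  (G (barlowPos 1 (Real.sqrt 6 / 3) s q.1 q.2.1 q.2.2)))) / p := by
  rintro ⟨κ, hκ, hL⟩
  refine ⟨κ, hκ, ?_⟩
  intro s p hp hs hH G hG
  obtain ⟨A, a, h, ha1, ha2, hh1, hh2, hfar⟩ := hL G hG
  refine ⟨A, a, h, ha1, ha2, hh1, hh2, ?_⟩
  intro m u v hn
  have ha : 0 < a := by linarith
  have hh : 0 < h := by nlinarith
  have hW := stub_wordFreeLeExcess 1 (Real.sqrt 6 / 3) a h s p one_pos cbbc_sqrt_six_div_three_pos ha hh hp hs hH G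
  have hsite := hfar (haggLabel s m) m u v (by rw [← cbbc_barlowPos_eq_layerVec]; exact hn)
  rw [← cbbc_barlowPos_eq_layerVec, ← cbbc_barlowPos_eq_layerVec] at hsite
  dsimp only at hW hsite
  linarith

/-- **`LatticeLandscape⅒ → CBBC` (v6 signature, `r ≤ 1/10`; stub piece
`stub_cauchyBornBarlowCoercivity_of_latticeLandscapeTenth`, proved)**: as `stub_cauchyBornBarlowCoercivity_of_latticeLandscape`,
with `r ≤ min(dist, 1/10)` at the witness site. [folklore] -/
theorem stub_cauchyBornBarlowCoercivity_of_latticeLandscapeTenth :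
    (∃ κ : ℝ, 0 < κ ∧ ∀ (s : ℤ → ℤ) (p : ℕ) (hp : p ≠ 0) (hs : ∀ i, s (i + p) = s i), IsHaggSeq s →
      ∀ (G : EuclideanSpace ℝ (Fin 3) ≃L[ℝ] EuclideanSpace ℝ (Fin 3)),
        (∀ v : EuclideanSpace ℝ (Fin 3), 4 / 5 * ‖v‖ ≤ ‖G v‖ ∧ ‖G v‖ ≤ 6 / 5 * ‖v‖) →
        ∃ (A : EuclideanSpace ℝ (Fin 3) →ₗᵢ[ℝ] EuclideanSpace ℝ (Fin 3)) (a h : ℝ),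
          47 / 50 ≤ a ∧ a ≤ 1 ∧ 39 / 50 * a ≤ h ∧ h ≤ 17 / 20 * a ∧
          ∀ m u v : ℤ, ‖barlowPos 1 (Real.sqrt 6 / 3) s m u v‖ ≤ 3 →
            (∑ n ∈ Finset.range p, barlowSiteEnergy lennardJones a h s n) / p +
                κ * (min (dist (G (barlowPos 1 (Real.sqrt 6 / 3) s m u v)) (A (barlowPos a h s m u v))) (1 / 10)) ^ 2 ≤
              (∑ n ∈ Finset.range p, (1 / 2 : ℝ) * ∑' q : ℤ × ℤ × ℤ,
                lennardJones (dist (G (barlowPos 1 (Real.sqrt 6 / 3) s n 0 0))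
                  (G (barlowPos 1 (Real.sqrt 6 / 3) s q.1 q.2.1 q.2.2)))) / p) →
    ∃ κ : ℝ, 0 < κ ∧ ∀ (s : ℤ → ℤ) (p : ℕ) (hp : p ≠ 0) (hs : ∀ i, s (i + p) = s i), IsHaggSeq s →
      ∀ (G : EuclideanSpace ℝ (Fin 3) ≃L[ℝ] EuclideanSpace ℝ (Fin 3)),
        (∀ v : EuclideanSpace ℝ (Fin 3), 4 / 5 * ‖v‖ ≤ ‖G v‖ ∧ ‖G v‖ ≤ 6 / 5 * ‖v‖) →
        ∀ r : ℝ, 0 ≤ r → r ≤ 1 / 10 →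
          (∀ (A : EuclideanSpace ℝ (Fin 3) →ₗᵢ[ℝ] EuclideanSpace ℝ (Fin 3)) (a h : ℝ), 47 / 50 ≤ a → a ≤ 1 → 39 / 50 * a ≤ h → h ≤ 17 / 20 * a →
            ∃ m u v : ℤ, ‖barlowPos 1 (Real.sqrt 6 / 3) s m u v‖ ≤ 3 ∧
              r ≤ dist (G (barlowPos 1 (Real.sqrt 6 / 3) s m u v)) (A (barlowPos a h s m u v))) →
          (⨅ Q : PeriodicConfiguration 3, Q.energyPerParticle lennardJones) + κ * r ^ 2 ≤
            ((barlowPeriodicConfiguration s one_ne_zero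
                (div_ne_zero (Real.sqrt_ne_zero'.2 (by norm_num)) three_ne_zero : Real.sqrt 6 / 3 ≠ 0) hp hs).linearImage
              G).energyPerParticle lennardJones := by
  rintro ⟨κ, hκ, hL⟩
  refine ⟨κ, hκ, ?_⟩
  intro s p hp hs hH G hG r hr hr10 hfar
  obtain ⟨A, a, h, ha1, ha2, hh1, hh2, hmain⟩ := hL s p hp hs hH G hG
  obtain ⟨m, u, v, hn, hrd⟩ := hfar A a h ha1 ha2 hh1 hh2
  have key := hmain m u v hn
  have ha : 0 < a := by linarith
  have hh : 0 < h := by nlinarith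
  have hfloor : (⨅ Q : PeriodicConfiguration 3, Q.energyPerParticle lennardJones) ≤
      (∑ n ∈ Finset.range p, barlowSiteEnergy lennardJones a h s n) / p := by
    rw [← energyPerParticle_barlow_eq_average ha hh ha.ne' hh.ne' hp hs]
    exact ciInf_le bddBelow_energyPerParticle_lennardJones _
  have hident := energyPerParticle_linearImage_barlow_eq_average lennardJones lennardJones_zero one_pos
    cbbc_sqrt_six_div_three_pos one_ne_zero
    (div_ne_zero (Real.sqrt_ne_zero'.2 (by norm_num)) three_ne_zero : Real.sqrt 6 / 3 ≠ 0) hp hs G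
  rw [hident]
  have hrmin : r ≤ min (dist (G (barlowPos 1 (Real.sqrt 6 / 3) s m u v)) (A (barlowPos a h s m u v))) (1 / 10) :=
    le_min hrd hr10
  have hr2 : r ^ 2 ≤ (min (dist (G (barlowPos 1 (Real.sqrt 6 / 3) s m u v)) (A (barlowPos a h s m u v))) (1 / 10)) ^ 2 :=
    pow_le_pow_left₀ hr hrmin 2
  have hκr := mul_le_mul_of_nonneg_left hr2 hκ.le
  linarith

/-- **`LayerLandscape⅒ → CBBC` (v6 signature; stub piece `stub_cauchyBornBarlowCoercivity_of_layerLandscapeTenth`,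
proved): the registered stub `stub_cauchyBornBarlowCoercivity` follows from the WORD-FREE capped landscape
inequality** — one inequality about explicit deformed layer sums of the unit triangular layers under `G`, quantified
over the `4/5–6/5` tube only (no word, no `e*`). [folklore] -/
theorem stub_cauchyBornBarlowCoercivity_of_layerLandscapeTenth :
    (∃ κ : ℝ, 0 < κ ∧ ∀ (G : EuclideanSpace ℝ (Fin 3) ≃L[ℝ] EuclideanSpace ℝ (Fin 3)),
        (∀ v : EuclideanSpace ℝ (Fin 3), 4 / 5 * ‖v‖ ≤ ‖G v‖ ∧ ‖G v‖ ≤ 6 / 5 * ‖v‖) →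
        ∃ (A : EuclideanSpace ℝ (Fin 3) →ₗᵢ[ℝ] EuclideanSpace ℝ (Fin 3)) (a h : ℝ),
          47 / 50 ≤ a ∧ a ≤ 1 ∧ 39 / 50 * a ≤ h ∧ h ≤ 17 / 20 * a ∧
          ∀ δ k i j : ℤ, ‖layerVec 1 (Real.sqrt 6 / 3) δ k i j‖ ≤ 3 →
            κ * (min (dist (G (layerVec 1 (Real.sqrt 6 / 3) δ k i j)) (A (layerVec a h δ k i j))) (1 / 10)) ^ 2 ≤
            (fun Δ : ℤ → ℤ → ℝ => (1 / 2 : ℝ) * (Δ 0 0 +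
              (∑' k : ℕ, if k = 0 then min (Δ 1 1) (Δ (-1) 1)
                else min (Δ 0 ((k : ℤ) + 1)) (min (Δ 1 ((k : ℤ) + 1)) (Δ (-1) ((k : ℤ) + 1)))) +
              (∑' k : ℕ, if k = 0 then min (Δ 1 (-1)) (Δ (-1) (-1))
                else min (Δ 0 (-((k : ℤ) + 1))) (min (Δ 1 (-((k : ℤ) + 1))) (Δ (-1) (-((k : ℤ) + 1)))))))
            (fun δ t => (∑' ij : ℤ × ℤ, lennardJones ‖G (layerVec 1 (Real.sqrt 6 / 3) δ t ij.1 ij.2)‖) -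
              layerInteraction lennardJones a h δ t)) →
    ∃ κ : ℝ, 0 < κ ∧ ∀ (s : ℤ → ℤ) (p : ℕ) (hp : p ≠ 0) (hs : ∀ i, s (i + p) = s i), IsHaggSeq s →
      ∀ (G : EuclideanSpace ℝ (Fin 3) ≃L[ℝ] EuclideanSpace ℝ (Fin 3)),
        (∀ v : EuclideanSpace ℝ (Fin 3), 4 / 5 * ‖v‖ ≤ ‖G v‖ ∧ ‖G v‖ ≤ 6 / 5 * ‖v‖) →
        ∀ r : ℝ, 0 ≤ r → r ≤ 1 / 10 →
          (∀ (A : EuclideanSpace ℝ (Fin 3) →ₗᵢ[ℝ] EuclideanSpace ℝ (Fin 3)) (a h : ℝ), 47 / 50 ≤ a → a ≤ 1 → 39 / 50 * a ≤ h → h ≤ 17 / 20 * a →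
            ∃ m u v : ℤ, ‖barlowPos 1 (Real.sqrt 6 / 3) s m u v‖ ≤ 3 ∧
              r ≤ dist (G (barlowPos 1 (Real.sqrt 6 / 3) s m u v)) (A (barlowPos a h s m u v))) →
          (⨅ Q : PeriodicConfiguration 3, Q.energyPerParticle lennardJones) + κ * r ^ 2 ≤
            ((barlowPeriodicConfiguration s one_ne_zero
                (div_ne_zero (Real.sqrt_ne_zero'.2 (by norm_num)) three_ne_zero : Real.sqrt 6 / 3 ≠ 0) hp hs).linearImage
              G).energyPerParticle lennardJones :=
  fun hL => stub_cauchyBornBarlowCoercivity_of_latticeLandscapeTenth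
    (stub_latticeLandscapeTenth_of_layerLandscapeTenth hL)

end Reductions

end Summit.AtomisticToContinuum.Crystallization.Theorems.NashClassCertificatesNashNearField

end
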